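import Summits.KontsevichZagierPeriods.Zeta5Search.Barrier.ConeGammaRates

/-!
# ζ(5) search — BARRIER: root tracking for a cubic with three simple real roots (the analytic toolkit)

HONEST FRAMING (cell `pub-zeta5`): systematic search; no irrationality claim unless kernel-certified. MODEL objects
under Brown–Zudilin's (28)+(30) accounting ([BZ22] = arXiv:2210.03391; (28) observed, not proved); this file is
elementary real analysis (intermediate value theorem, local Lipschitz bounds) plus bookkeeping for the sSup-form
`C1`/`C0` of `ConeGammaRates`; nothing here is a statement about the size of any critical value, the cone's supremum
(C2 = `BarrierC2`, OPEN), S-E (CONJECTURED) or `ζ(5)`. No number or sentence of record moves. Records in print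
UNMOVED. Prover P2 g23 (self-selected Lean-only item «BZ's cubic (20) in the kernel», file 2: the toolkit that
replaces «the implicit function theorem on BZ's critical system — NOT in the tree» of `ConeGammaLogCuspGamma`).

* `cubicFun_eq_prod_of_roots`, `cubicFun_leadCoeff_ne_zero`, `cubicFun_root_cases` — a cubic function with three
  distinct zeros `Y₁, Y₂, Y₃` is `a·(Y−Y₁)(Y−Y₂)(Y−Y₃)`; if it is not identically zero then `a ≠ 0` and these are
  all its zeros (elementary: a quadratic with three zeros vanishes).
* **`exists_root_near`** — ROOT TRACKING. A family `F s' : ℝ → ℝ` of continuous functions, parametrised by `s'` in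
  a normed group, with `|F s' Y − F s Y| ≤ K‖s' − s‖` near `(s, Y₁)` and `F s = a·(Y−Y₁)(Y−Y₂)(Y−Y₃)` (`a ≠ 0`,
  `Y₁ ≠ Y₂, Y₃`): there are `L, η > 0` such that for `‖s' − s‖ ≤ η` the function `F s'` has a zero `Y` with
  `|Y − Y₁| ≤ L·‖s' − s‖` (IVT on `[Y₁ − Lρ, Y₁ + Lρ]` against the linear lower bound `|F s (Y₁ ± t)| ≥ |w₀|t/2`,
  `w₀ = a(Y₁−Y₂)(Y₁−Y₃)`).
* `exists_ball_ne_zero` — a continuous side condition `G(s, Y₁) ≠ 0` persists on a ball;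
  `exists_local_lipschitz_of_contDiffAt` — a `C¹` function of `(s, Y)` is Lipschitz on a ball (Mathlib's
  `ContDiffAt.exists_lipschitzOnWith`, unpacked in the max-distance of the product).
* `exists_sorted_three`, `C1_eq_of_critVals_eq_three`, `C0_eq_of_critVals_eq_three`, `regular_of_critVals_eq_three`
  — with `critVals a = {u, v, w}`, `u < v < w`: `C1 a = w`, `C0 a = v`, `Regular a`.
-/

noncomputable section

open Set Metric
open scoped Topology NNReal

namespace Summit.KontsevichZagierPeriods.Zeta5Search.Barrier.ConeGamma

/-! ### Three distinct zeros factor a cubic function -/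

/-- **Three distinct zeros factor a cubic**: if `C(Y) = aY³ + bY² + cY + d` vanishes at pairwise distinct
`Y₁, Y₂, Y₃` then `C(Y) = a·(Y−Y₁)(Y−Y₂)(Y−Y₃)` for every `Y` (the difference is a quadratic with three zeros). -/
theorem cubicFun_eq_prod_of_roots {C : ℝ → ℝ} {a b c d : ℝ} (hC : ∀ Y, C Y = a * Y ^ 3 + b * Y ^ 2 + c * Y + d)
    {Y₁ Y₂ Y₃ : ℝ} (h1 : C Y₁ = 0) (h2 : C Y₂ = 0) (h3 : C Y₃ = 0) (h12 : Y₁ ≠ Y₂) (h13 : Y₁ ≠ Y₃)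
    (h23 : Y₂ ≠ Y₃) (Y : ℝ) : C Y = a * ((Y - Y₁) * (Y - Y₂) * (Y - Y₃)) := by
  rw [hC] at h1 h2 h3
  -- the quadratic `g = C − a·Π` with coefficients `b', c', d'` vanishes at the three points
  have g1 : (b + a * (Y₁ + Y₂ + Y₃)) * Y₁ ^ 2 + (c - a * (Y₁ * Y₂ + Y₁ * Y₃ + Y₂ * Y₃)) * Y₁
      + (d + a * (Y₁ * Y₂ * Y₃)) = 0 := by linear_combination h1
  have g2 : (b + a * (Y₁ + Y₂ + Y₃)) * Y₂ ^ 2 + (c - a * (Y₁ * Y₂ + Y₁ * Y₃ + Y₂ * Y₃)) * Y₂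
      + (d + a * (Y₁ * Y₂ * Y₃)) = 0 := by linear_combination h2
  have g3 : (b + a * (Y₁ + Y₂ + Y₃)) * Y₃ ^ 2 + (c - a * (Y₁ * Y₂ + Y₁ * Y₃ + Y₂ * Y₃)) * Y₃
      + (d + a * (Y₁ * Y₂ * Y₃)) = 0 := by linear_combination h3
  have e12 : (b + a * (Y₁ + Y₂ + Y₃)) * (Y₁ + Y₂) + (c - a * (Y₁ * Y₂ + Y₁ * Y₃ + Y₂ * Y₃)) = 0 := by
    have h : (Y₁ - Y₂) * ((b + a * (Y₁ + Y₂ + Y₃)) * (Y₁ + Y₂) + (c - a * (Y₁ * Y₂ + Y₁ * Y₃ + Y₂ * Y₃))) = 0 := by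
      linear_combination g1 - g2
    exact (mul_eq_zero.mp h).resolve_left (sub_ne_zero.mpr h12)
  have e13 : (b + a * (Y₁ + Y₂ + Y₃)) * (Y₁ + Y₃) + (c - a * (Y₁ * Y₂ + Y₁ * Y₃ + Y₂ * Y₃)) = 0 := by
    have h : (Y₁ - Y₃) * ((b + a * (Y₁ + Y₂ + Y₃)) * (Y₁ + Y₃) + (c - a * (Y₁ * Y₂ + Y₁ * Y₃ + Y₂ * Y₃))) = 0 := by
      linear_combination g1 - g3
    exact (mul_eq_zero.mp h).resolve_left (sub_ne_zero.mpr h13)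
  have hb : b + a * (Y₁ + Y₂ + Y₃) = 0 := by
    have h : (Y₂ - Y₃) * (b + a * (Y₁ + Y₂ + Y₃)) = 0 := by linear_combination e12 - e13
    exact (mul_eq_zero.mp h).resolve_left (sub_ne_zero.mpr h23)
  have hc : c - a * (Y₁ * Y₂ + Y₁ * Y₃ + Y₂ * Y₃) = 0 := by linear_combination e12 - (Y₁ + Y₂) * hb
  have hd : d + a * (Y₁ * Y₂ * Y₃) = 0 := by linear_combination g1 - Y₁ ^ 2 * hb - Y₁ * hc
  rw [hC]
  linear_combination Y ^ 2 * hb + Y * hc + hd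

/-- If moreover `C` is not identically zero, the leading coefficient is non-zero. -/
theorem cubicFun_leadCoeff_ne_zero {C : ℝ → ℝ} {a b c d : ℝ} (hC : ∀ Y, C Y = a * Y ^ 3 + b * Y ^ 2 + c * Y + d)
    {Y₁ Y₂ Y₃ : ℝ} (h1 : C Y₁ = 0) (h2 : C Y₂ = 0) (h3 : C Y₃ = 0) (h12 : Y₁ ≠ Y₂) (h13 : Y₁ ≠ Y₃)
    (h23 : Y₂ ≠ Y₃) {Y₀ : ℝ} (h0 : C Y₀ ≠ 0) : a ≠ 0 := by
  intro ha
  apply h0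
  rw [cubicFun_eq_prod_of_roots hC h1 h2 h3 h12 h13 h23 Y₀, ha, zero_mul]

/-- … and every zero is one of `Y₁, Y₂, Y₃`. -/
theorem cubicFun_root_cases {C : ℝ → ℝ} {a b c d : ℝ} (hC : ∀ Y, C Y = a * Y ^ 3 + b * Y ^ 2 + c * Y + d)
    {Y₁ Y₂ Y₃ : ℝ} (h1 : C Y₁ = 0) (h2 : C Y₂ = 0) (h3 : C Y₃ = 0) (h12 : Y₁ ≠ Y₂) (h13 : Y₁ ≠ Y₃)
    (h23 : Y₂ ≠ Y₃) {Y₀ : ℝ} (h0 : C Y₀ ≠ 0) {Y : ℝ} (hY : C Y = 0) : Y = Y₁ ∨ Y = Y₂ ∨ Y = Y₃ := by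
  have ha := cubicFun_leadCoeff_ne_zero hC h1 h2 h3 h12 h13 h23 h0
  rw [cubicFun_eq_prod_of_roots hC h1 h2 h3 h12 h13 h23 Y] at hY
  rcases mul_eq_zero.mp hY with h | h
  · exact absurd h ha
  rcases mul_eq_zero.mp h with h | h
  · rcases mul_eq_zero.mp h with h | h
    · exact Or.inl (sub_eq_zero.mp h)
    · exact Or.inr (Or.inl (sub_eq_zero.mp h))
  · exact Or.inr (Or.inr (sub_eq_zero.mp h))

/-! ### Root tracking: a simple real root persists and moves Lipschitz-ly -/

/-- `w₀·w ≥ w₀²/2` when `|w − w₀| ≤ |w₀|/2`. -/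
theorem mul_ge_half_sq_of_near {w w₀ : ℝ} (h : |w - w₀| ≤ |w₀| / 2) : w₀ ^ 2 / 2 ≤ w₀ * w := by
  have h1 : |w₀ * (w - w₀)| ≤ w₀ ^ 2 / 2 := by
    rw [abs_mul]
    calc |w₀| * |w - w₀| ≤ |w₀| * (|w₀| / 2) := mul_le_mul_of_nonneg_left h (abs_nonneg _)
      _ = w₀ ^ 2 / 2 := by rw [← sq_abs w₀]; ring
  have h2 := neg_abs_le (w₀ * (w - w₀))
  have h3 : w₀ * w = w₀ * (w - w₀) + w₀ ^ 2 := by ring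
  linarith

/-- **ROOT TRACKING (the implicit-function substitute).** Let `F s'` (`s'` in a normed group) be continuous on
`[Y₁−η₀, Y₁+η₀]` with `|F s' Y − F s Y| ≤ K·‖s' − s‖` there for `‖s' − s‖ ≤ η₀`, and let the base function factor
as `F s Y = a·(Y−Y₁)(Y−Y₂)(Y−Y₃)` with `a ≠ 0`, `Y₁ ≠ Y₂`, `Y₁ ≠ Y₃` (a SIMPLE root `Y₁`). Then there are `L, η > 0`
(`η ≤ η₀`, `Lη ≤ η₀`) such that for every `s'` with `‖s' − s‖ ≤ η` the function `F s'` has a zero `Y` with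
`|Y − Y₁| ≤ L·‖s' − s‖`. -/
theorem exists_root_near {E : Type*} [NormedAddCommGroup E] {F : E → ℝ → ℝ} {s : E}
    {a Y₁ Y₂ Y₃ K η₀ : ℝ} (hη₀ : 0 < η₀) (hK : 0 ≤ K)
    (hlip : ∀ s' Y, ‖s' - s‖ ≤ η₀ → |Y - Y₁| ≤ η₀ → |F s' Y - F s Y| ≤ K * ‖s' - s‖)
    (hcont : ∀ s', ‖s' - s‖ ≤ η₀ → ContinuousOn (F s') (Icc (Y₁ - η₀) (Y₁ + η₀)))
    (hbase : ∀ Y, F s Y = a * ((Y - Y₁) * (Y - Y₂) * (Y - Y₃))) (ha : a ≠ 0) (h12 : Y₁ ≠ Y₂) (h13 : Y₁ ≠ Y₃) :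
    ∃ L η : ℝ, 0 < L ∧ 0 < η ∧ η ≤ η₀ ∧ L * η ≤ η₀ ∧
      ∀ s', ‖s' - s‖ ≤ η → ∃ Y, F s' Y = 0 ∧ |Y - Y₁| ≤ L * ‖s' - s‖ := by
  -- the cofactor `w(Y) = a(Y−Y₂)(Y−Y₃)` and its value `w₀ ≠ 0` at `Y₁`
  have hw₀ne : a * ((Y₁ - Y₂) * (Y₁ - Y₃)) ≠ 0 :=
    mul_ne_zero ha (mul_ne_zero (sub_ne_zero.mpr h12) (sub_ne_zero.mpr h13))
  have hw₀pos : 0 < |a * ((Y₁ - Y₂) * (Y₁ - Y₃))| := abs_pos.mpr hw₀ne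
  have hwc : ContinuousAt (fun Y => a * ((Y - Y₂) * (Y - Y₃))) Y₁ := by fun_prop
  obtain ⟨g, hg, hgw⟩ := Metric.continuousAt_iff.mp hwc (|a * ((Y₁ - Y₂) * (Y₁ - Y₃))| / 2) (by positivity)
  -- the constants
  obtain ⟨L, hLdef⟩ : ∃ L : ℝ, L = 2 * K / |a * ((Y₁ - Y₂) * (Y₁ - Y₃))| + 1 := ⟨_, rfl⟩
  have hL : 0 < L := by rw [hLdef]; positivity
  have hLK : K < L * |a * ((Y₁ - Y₂) * (Y₁ - Y₃))| / 2 := by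
    rw [hLdef, add_mul, div_mul_cancel₀ _ hw₀pos.ne']
    linarith
  obtain ⟨η, hηdef⟩ : ∃ η : ℝ, η = min η₀ (min (g / (2 * L)) (η₀ / L)) := ⟨_, rfl⟩
  have hη : 0 < η := by rw [hηdef]; positivity
  have hη₁ : η ≤ η₀ := by rw [hηdef]; exact min_le_left _ _
  have hη₂ : L * η ≤ g / 2 := by
    have : η ≤ g / (2 * L) := by rw [hηdef]; exact (min_le_right _ _).trans (min_le_left _ _)
    calc L * η ≤ L * (g / (2 * L)) := mul_le_mul_of_nonneg_left this hL.le
      _ = g / 2 := by field_simp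
  have hη₃ : L * η ≤ η₀ := by
    have : η ≤ η₀ / L := by rw [hηdef]; exact (min_le_right _ _).trans (min_le_right _ _)
    calc L * η ≤ L * (η₀ / L) := mul_le_mul_of_nonneg_left this hL.le
      _ = η₀ := by field_simp
  refine ⟨L, η, hL, hη, hη₁, hη₃, fun s' hs' => ?_⟩
  rcases eq_or_lt_of_le (norm_nonneg (s' - s)) with h0 | hρ
  · -- `s' = s`: the root itself
    have hss : s' = s := by rw [eq_comm, norm_eq_zero, sub_eq_zero] at h0; exact h0
    refine ⟨Y₁, ?_, by rw [← h0, sub_self]; simp⟩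
    rw [hss, hbase]; ring
  · -- `ρ = ‖s' − s‖ > 0`, `τ = Lρ`
    have hτ : 0 < L * ‖s' - s‖ := mul_pos hL hρ
    have hτg : L * ‖s' - s‖ < g := by
      have := mul_le_mul_of_nonneg_left hs' hL.le
      linarith
    have hτη : L * ‖s' - s‖ ≤ η₀ := (mul_le_mul_of_nonneg_left hs' hL.le).trans hη₃
    have hρη : ‖s' - s‖ ≤ η₀ := hs'.trans hη₁
    -- the base function at `Y₁ ± τ`
    have hplus : F s (Y₁ + L * ‖s' - s‖)
        = L * ‖s' - s‖ * (a * ((Y₁ + L * ‖s' - s‖ - Y₂) * (Y₁ + L * ‖s' - s‖ - Y₃))) := by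
      rw [hbase]; ring
    have hminus : F s (Y₁ - L * ‖s' - s‖)
        = -(L * ‖s' - s‖) * (a * ((Y₁ - L * ‖s' - s‖ - Y₂) * (Y₁ - L * ‖s' - s‖ - Y₃))) := by
      rw [hbase]; ring
    -- the cofactor stays within `|w₀|/2` of `w₀`
    have hw1 : |a * ((Y₁ + L * ‖s' - s‖ - Y₂) * (Y₁ + L * ‖s' - s‖ - Y₃)) - a * ((Y₁ - Y₂) * (Y₁ - Y₃))|
        ≤ |a * ((Y₁ - Y₂) * (Y₁ - Y₃))| / 2 := by
      have h := @hgw (Y₁ + L * ‖s' - s‖) (by rw [Real.dist_eq, add_sub_cancel_left, abs_of_pos hτ]; exact hτg)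
      rw [Real.dist_eq] at h
      exact h.le
    have hw2 : |a * ((Y₁ - L * ‖s' - s‖ - Y₂) * (Y₁ - L * ‖s' - s‖ - Y₃)) - a * ((Y₁ - Y₂) * (Y₁ - Y₃))|
        ≤ |a * ((Y₁ - Y₂) * (Y₁ - Y₃))| / 2 := by
      have h := @hgw (Y₁ - L * ‖s' - s‖)
        (by rw [Real.dist_eq, sub_sub_cancel_left, abs_neg, abs_of_pos hτ]; exact hτg)
      rw [Real.dist_eq] at h
      exact h.le
    have k1 := mul_ge_half_sq_of_near hw1
    have k2 := mul_ge_half_sq_of_near hw2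
    -- the perturbation is at most `K ρ` in size
    have d1 : |F s' (Y₁ + L * ‖s' - s‖) - F s (Y₁ + L * ‖s' - s‖)| ≤ K * ‖s' - s‖ :=
      hlip s' _ hρη (by rw [add_sub_cancel_left, abs_of_pos hτ]; exact hτη)
    have d2 : |F s' (Y₁ - L * ‖s' - s‖) - F s (Y₁ - L * ‖s' - s‖)| ≤ K * ‖s' - s‖ :=
      hlip s' _ hρη (by rw [sub_sub_cancel_left, abs_neg, abs_of_pos hτ]; exact hτη)
    have d1' : |a * ((Y₁ - Y₂) * (Y₁ - Y₃)) * (F s' (Y₁ + L * ‖s' - s‖) - F s (Y₁ + L * ‖s' - s‖))|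
        ≤ |a * ((Y₁ - Y₂) * (Y₁ - Y₃))| * (K * ‖s' - s‖) := by
      rw [abs_mul]; exact mul_le_mul_of_nonneg_left d1 (abs_nonneg _)
    have d2' : |a * ((Y₁ - Y₂) * (Y₁ - Y₃)) * (F s' (Y₁ - L * ‖s' - s‖) - F s (Y₁ - L * ‖s' - s‖))|
        ≤ |a * ((Y₁ - Y₂) * (Y₁ - Y₃))| * (K * ‖s' - s‖) := by
      rw [abs_mul]; exact mul_le_mul_of_nonneg_left d2 (abs_nonneg _)
    have d1'' := (abs_le.mp d1').1
    have d2'' := (abs_le.mp d2').2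
    -- the decisive margin `τ·w₀²/2 − |w₀|·K·ρ = ρ|w₀|(L|w₀|/2 − K) > 0`
    have margin : 0 < L * ‖s' - s‖ * ((a * ((Y₁ - Y₂) * (Y₁ - Y₃))) ^ 2 / 2)
        - |a * ((Y₁ - Y₂) * (Y₁ - Y₃))| * (K * ‖s' - s‖) := by
      have key : 0 < ‖s' - s‖ * |a * ((Y₁ - Y₂) * (Y₁ - Y₃))|
          * (L * |a * ((Y₁ - Y₂) * (Y₁ - Y₃))| / 2 - K) :=
        mul_pos (mul_pos hρ hw₀pos) (sub_pos.mpr hLK)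
      have e : L * ‖s' - s‖ * ((a * ((Y₁ - Y₂) * (Y₁ - Y₃))) ^ 2 / 2)
          - |a * ((Y₁ - Y₂) * (Y₁ - Y₃))| * (K * ‖s' - s‖)
          = ‖s' - s‖ * |a * ((Y₁ - Y₂) * (Y₁ - Y₃))| * (L * |a * ((Y₁ - Y₂) * (Y₁ - Y₃))| / 2 - K) := by
        rw [← sq_abs (a * ((Y₁ - Y₂) * (Y₁ - Y₃)))]; ring
      rw [e]; exact key
    have t1 : L * ‖s' - s‖ * ((a * ((Y₁ - Y₂) * (Y₁ - Y₃))) ^ 2 / 2)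
        ≤ L * ‖s' - s‖ * (a * ((Y₁ - Y₂) * (Y₁ - Y₃))
            * (a * ((Y₁ + L * ‖s' - s‖ - Y₂) * (Y₁ + L * ‖s' - s‖ - Y₃)))) :=
      mul_le_mul_of_nonneg_left k1 hτ.le
    have t2 : L * ‖s' - s‖ * ((a * ((Y₁ - Y₂) * (Y₁ - Y₃))) ^ 2 / 2)
        ≤ L * ‖s' - s‖ * (a * ((Y₁ - Y₂) * (Y₁ - Y₃))
            * (a * ((Y₁ - L * ‖s' - s‖ - Y₂) * (Y₁ - L * ‖s' - s‖ - Y₃)))) :=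
      mul_le_mul_of_nonneg_left k2 hτ.le
    have pos1 : 0 < a * ((Y₁ - Y₂) * (Y₁ - Y₃)) * F s' (Y₁ + L * ‖s' - s‖) := by
      have e : a * ((Y₁ - Y₂) * (Y₁ - Y₃)) * F s' (Y₁ + L * ‖s' - s‖)
          = a * ((Y₁ - Y₂) * (Y₁ - Y₃)) * (F s' (Y₁ + L * ‖s' - s‖) - F s (Y₁ + L * ‖s' - s‖))
            + L * ‖s' - s‖ * (a * ((Y₁ - Y₂) * (Y₁ - Y₃))
              * (a * ((Y₁ + L * ‖s' - s‖ - Y₂) * (Y₁ + L * ‖s' - s‖ - Y₃)))) := by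
        rw [hplus]; ring
      rw [e]; linarith
    have neg1 : a * ((Y₁ - Y₂) * (Y₁ - Y₃)) * F s' (Y₁ - L * ‖s' - s‖) < 0 := by
      have e : a * ((Y₁ - Y₂) * (Y₁ - Y₃)) * F s' (Y₁ - L * ‖s' - s‖)
          = a * ((Y₁ - Y₂) * (Y₁ - Y₃)) * (F s' (Y₁ - L * ‖s' - s‖) - F s (Y₁ - L * ‖s' - s‖))
            - L * ‖s' - s‖ * (a * ((Y₁ - Y₂) * (Y₁ - Y₃))
              * (a * ((Y₁ - L * ‖s' - s‖ - Y₂) * (Y₁ - L * ‖s' - s‖ - Y₃)))) := by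
        rw [hminus]; ring
      rw [e]; linarith
    -- IVT on `[Y₁ − τ, Y₁ + τ]`
    have hsub : Icc (Y₁ - L * ‖s' - s‖) (Y₁ + L * ‖s' - s‖) ⊆ Icc (Y₁ - η₀) (Y₁ + η₀) :=
      Icc_subset_Icc (by linarith) (by linarith)
    have hcont' : ContinuousOn (F s') (Icc (Y₁ - L * ‖s' - s‖) (Y₁ + L * ‖s' - s‖)) :=
      (hcont s' hρη).mono hsub
    have hle : Y₁ - L * ‖s' - s‖ ≤ Y₁ + L * ‖s' - s‖ := by linarith
    have hroot : ∃ Y ∈ Icc (Y₁ - L * ‖s' - s‖) (Y₁ + L * ‖s' - s‖), F s' Y = 0 := by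
      rcases lt_or_gt_of_ne hw₀ne with hwneg | hwpos
      · have hb : F s' (Y₁ + L * ‖s' - s‖) < 0 := by
          by_contra hcon; rw [not_lt] at hcon
          have := mul_nonpos_of_nonpos_of_nonneg hwneg.le hcon
          linarith
        have ha' : 0 < F s' (Y₁ - L * ‖s' - s‖) := by
          by_contra hcon; rw [not_lt] at hcon
          have := mul_nonneg_of_nonpos_of_nonpos hwneg.le hcon
          linarith
        exact intermediate_value_Icc' hle hcont' ⟨hb.le, ha'.le⟩
      · have hb : 0 < F s' (Y₁ + L * ‖s' - s‖) := by
          by_contra hcon; rw [not_lt] at hcon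
          have := mul_nonpos_of_nonneg_of_nonpos hwpos.le hcon
          linarith
        have ha' : F s' (Y₁ - L * ‖s' - s‖) < 0 := by
          by_contra hcon; rw [not_lt] at hcon
          have := mul_nonneg hwpos.le hcon
          linarith
        exact intermediate_value_Icc hle hcont' ⟨ha'.le, hb.le⟩
    obtain ⟨Y, hYmem, hY0⟩ := hroot
    exact ⟨Y, hY0, abs_le.mpr ⟨by linarith [hYmem.1], by linarith [hYmem.2]⟩⟩

/-! ### Side conditions persist; `C¹` functions are locally Lipschitz (product max-distance, unpacked) -/

/-- **A continuous side condition persists on a ball**: if `G` is continuous at `(s, Y₁)` with `G(s, Y₁) ≠ 0`,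
then `G(s', Y) ≠ 0` whenever `dist s' s ≤ η` and `|Y − Y₁| ≤ η`, for some `η > 0`. -/
theorem exists_ball_ne_zero {E : Type*} [PseudoMetricSpace E] {G : E × ℝ → ℝ} {s : E} {Y₁ : ℝ}
    (hG : ContinuousAt G (s, Y₁)) (h0 : G (s, Y₁) ≠ 0) :
    ∃ η : ℝ, 0 < η ∧ ∀ s' Y, dist s' s ≤ η → |Y - Y₁| ≤ η → G (s', Y) ≠ 0 := by
  obtain ⟨ε, hε, h⟩ := Metric.eventually_nhds_iff.mp (hG.eventually_ne h0)
  refine ⟨ε / 2, by positivity, fun s' Y hs hY => h ?_⟩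
  rw [Prod.dist_eq, Real.dist_eq]
  exact max_lt (by linarith) (by linarith)

/-- **A `C¹` function of `(s, Y)` is Lipschitz on a ball** (two-point form in the max-distance of the product):
`|V(s', Y) − V(s'', Y')| ≤ K·max ‖s' − s''‖ |Y − Y'|` for all four coordinates within `η` of `(s, Y₁)`. -/
theorem exists_local_lipschitz_of_contDiffAt {E : Type*} [NormedAddCommGroup E] [NormedSpace ℝ E]
    {V : E × ℝ → ℝ} {s : E} {Y₁ : ℝ} (hV : ContDiffAt ℝ 1 V (s, Y₁)) :
    ∃ K η : ℝ, 0 ≤ K ∧ 0 < η ∧ ∀ s' Y s'' Y', ‖s' - s‖ ≤ η → |Y - Y₁| ≤ η → ‖s'' - s‖ ≤ η → |Y' - Y₁| ≤ η →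
      |V (s', Y) - V (s'', Y')| ≤ K * max ‖s' - s''‖ |Y - Y'| := by
  obtain ⟨K, t, ht, hlip⟩ := hV.exists_lipschitzOnWith
  obtain ⟨ε, hε, hball⟩ := Metric.mem_nhds_iff.mp ht
  have hmem : ∀ s' Y, ‖s' - s‖ ≤ ε / 2 → |Y - Y₁| ≤ ε / 2 → (s', Y) ∈ t := by
    intro s' Y hs hY
    apply hball
    rw [Metric.mem_ball, Prod.dist_eq, dist_eq_norm, Real.dist_eq]
    exact max_lt (by linarith) (by linarith)
  refine ⟨K, ε / 2, K.coe_nonneg, by positivity, fun s' Y s'' Y' hs hY hs'' hY' => ?_⟩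
  have h := hlip.dist_le_mul _ (hmem s' Y hs hY) _ (hmem s'' Y' hs'' hY')
  rwa [Real.dist_eq, Prod.dist_eq, dist_eq_norm, Real.dist_eq] at h

/-! ### Three critical values by name: `C1 = max`, `C0 = middle`, `Regular` -/

/-- Three pairwise distinct reals can be listed in increasing order. -/
theorem exists_sorted_three {u v w : ℝ} (huv : u ≠ v) (huw : u ≠ w) (hvw : v ≠ w) :
    ∃ x y z : ℝ, x < y ∧ y < z ∧ ({u, v, w} : Set ℝ) = {x, y, z} := by
  rcases lt_or_gt_of_ne huv with h1 | h1 <;> rcases lt_or_gt_of_ne huw with h2 | h2 <;>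
    rcases lt_or_gt_of_ne hvw with h3 | h3
  · exact ⟨u, v, w, h1, h3, rfl⟩
  · exact ⟨u, w, v, h2, h3, by ext t; simp only [Set.mem_insert_iff, Set.mem_singleton_iff]; tauto⟩
  · exact absurd (h1.trans h3) (lt_asymm h2)
  · exact ⟨w, u, v, h2, h1, by ext t; simp only [Set.mem_insert_iff, Set.mem_singleton_iff]; tauto⟩
  · exact ⟨v, u, w, h1, h2, by ext t; simp only [Set.mem_insert_iff, Set.mem_singleton_iff]; tauto⟩
  · exact absurd (h2.trans h3) (lt_asymm h1)
  · exact ⟨v, w, u, h3, h2, by ext t; simp only [Set.mem_insert_iff, Set.mem_singleton_iff]; tauto⟩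
  · exact ⟨w, v, u, h3, h1, by ext t; simp only [Set.mem_insert_iff, Set.mem_singleton_iff]; tauto⟩

/-- **`C1 = the largest of three`**: if `critVals a = {u, v, w}` with `u < v < w` then `C1 a = w`. -/
theorem C1_eq_of_critVals_eq_three {a : Dir} {u v w : ℝ} (h : critVals a = {u, v, w}) (huv : u < v)
    (hvw : v < w) : C1 a = w := by
  rw [C1, h]
  apply le_antisymm
  · refine csSup_le (Set.insert_nonempty _ _) ?_
    rintro t (rfl | rfl | rfl)
    · exact (huv.trans hvw).le
    · exact hvw.le
    · exact le_rfl
  · exact le_csSup ((Set.toFinite _).bddAbove) (by simp)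

/-- **`C0 = the middle of three`**: if `critVals a = {u, v, w}` with `u < v < w` then `C0 a = v`. -/
theorem C0_eq_of_critVals_eq_three {a : Dir} {u v w : ℝ} (h : critVals a = {u, v, w}) (huv : u < v)
    (hvw : v < w) : C0 a = v := by
  rw [C0, C1_eq_of_critVals_eq_three h huv hvw, h]
  have hset : ({u, v, w} : Set ℝ) \ {w} = {u, v} := by
    ext t
    simp only [Set.mem_sdiff, Set.mem_insert_iff, Set.mem_singleton_iff]
    constructor
    · rintro ⟨h | h | h, hne⟩
      · exact Or.inl h
      · exact Or.inr h
      · exact absurd h hne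
    · rintro (h | h)
      · exact ⟨Or.inl h, by rw [h]; exact (huv.trans hvw).ne⟩
      · exact ⟨Or.inr (Or.inl h), by rw [h]; exact hvw.ne⟩
  rw [hset]
  apply le_antisymm
  · refine csSup_le (Set.insert_nonempty _ _) ?_
    rintro t (rfl | rfl)
    · exact huv.le
    · exact le_rfl
  · exact le_csSup ((Set.toFinite _).bddAbove) (by simp)

/-- Three pairwise distinct critical values make the direction `Regular`. -/
theorem regular_of_critVals_eq_three {a : Dir} {u v w : ℝ} (h : critVals a = {u, v, w}) (huv : u ≠ v)
    (huw : u ≠ w) (hvw : v ≠ w) : Regular a := by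
  rw [Regular, h, Set.ncard_eq_three]
  exact ⟨u, v, w, huv, huw, hvw, rfl⟩

end Summit.KontsevichZagierPeriods.Zeta5Search.Barrier.ConeGamma

end
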